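/-
Copyright (c) 2026 the pub-hodgecm-mathlib formalisation cell (harness21).  Prover seat hodgecm-mathlib-R90-CS-p03 (g2), R90-TF section S8 «ContSpec-n½» (taken by default after
deal S8-R85 ∕ S8-R105, census `R90/S8/CENSUS-ChiFiniteTransportU3.R90-CS-p03-g2.md`, file (a-2a)): the χ-WEIGHTED TWIN of ★ (3-iv-b) `K2E1IntertwiningFiniteTransportU3` at a
COMPLEX exponent — the finite part of the χ-intertwining integral of `U(2,1)_{L∕L⁺}` transported from `𝔸_{L,f} × 𝔸_{L⁺,f}` to the base coordinates of ★ (a-1) and evaluated as its Euler product.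
-/
import Summits.HodgeConjecture.HodgeConjecture.Theorems.K2E1ChiIntertwiningScalarEulerProductU3Finite   -- ★ (a-1) (R90-CS-p03 g0): `inv_measure_smul_integral_finprod_chi_eq_prod_mul_chiScalar_three`; brings ★ `AdelicProductIntegral`, ★ `K2E1IntertwiningLocalMeanCMU3`
import Summits.HodgeConjecture.HodgeConjecture.Theorems.K2E1WhittakerFinitePartTransportU3             -- ★ (K2E2-p12): the cpow dictionary `ofReal_coe_finprod_heightFactor_cpow_neg_eq`; brings ★ (3-iv-b) `exists_pos_integral_pi_three_eq_smul_integral_prod`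
import HarnessLib

/-!
# K2·E1 ∕ R90·S8 — `K2E1ChiIntertwiningFiniteTransportU3` (file (a-2a)): THE FINITE PART OF THE χ-WEIGHTED `U(2,1)` INTERTWINING INTEGRAL, TRANSPORTED AND EVALUATED —
# `∫_{𝔸_{L,f}×𝔸_{L⁺,f}} Ω(X,b)·h_f((X_∞,X),b)^{−z} d(μ_{L,f}⊗μ_{L⁺,f}) = C'·μ³(𝒪̂³)·(∏_{v∈S₀} m_v(z))·c_χ^S(z)` on `2 < Re z`, GIVEN the pure-tensor letter `Ω(Ψ^∞(x₀,x₁), x₂) = ∏ᶠ_v ω_v(x_v)`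

Cell `pub/hodgecm-mathlib`, crux h413 = `stmt-HodgeConjecture-24833`, route of record `HCCMUnconditional`; R90-TF section S8 «ContSpec-n½», road R2-χ₃ (the (V) scalar road: the
(V) seam ★ `R90S8ResGMidBlockNeBotOfLettersU3` takes `hsrc : q z = A z · c_χ^S(z)`; (a-1) ★ is `c_χ^S` in BASE coordinates; the global unfolding lands in `(X, b)` coordinates — this file
is the bridge, the χ-twin of ★ (3-iv-b)).  THEOREMS ONLY (no `def`, no `instance`, no notation, no named-fact hypothesis, no `sorry`; default heartbeats); lane
`--supports stmt-HodgeConjecture-24833 --as helper` (count-neutral).  Closes no socket.  TEMPLATE: ★ `K2E1WhittakerFinitePartTransportU3` (the ψ-twisted twin, K2E2-p12), line by line.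

THE MATHEMATICS ([TateThesis1967] Thm 3.3.1; [Langlands1971] §3; [Rogawski1990] §4.5, §13.9 p. 229; [WeilBNT1967] Ch. IV §1).  The CM transport `x ↦ (Ψ^∞(x₀,x₁), x₂)`,
`(𝔸_{L⁺,f})³ → 𝔸_{L,f} × 𝔸_{L⁺,f}`, carries `μ_{L⁺,f}^{⊗3}` to ONE positive multiple of `μ_{L,f} ⊗ μ_{L⁺,f}` (★ (3-iv-b) §1, EVERY integrand, with the integrability `iff`); along it the
finite height factor of ★ (a2)₃ is the Euler product of ★ (3-iii-a)'s local heights, as COMPLEX powers (★ `ofReal_coe_finprod_heightFactor_cpow_neg_eq`), and a PURE-TENSOR finite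
weight `Ω` — letter `hΩ : Ω(Ψ^∞(x₀,x₁), x₂) = ∏ᶠ_v ω_v(x_v)` (the content of the χ-section's factorisation along the big cell; (a-2b)'s business) — merges with it place by place (§1:
both Euler products are finitely supported, `x ∈ offBox T` ★, `ω_v = Q_v^{−z} = 1` on `𝒪_v³` off `S₀`).  Then ★ (a-1) `inv_measure_smul_integral_finprod_chi_eq_prod_mul_chiScalar_three`
(Tate 3.3.1 + the good-place tokens, letters `hgood hωc hω1 hin hsp`) evaluates the transported integral.
* §1 **`finprod_chiWeight_mul_finprod_localHeight_cpow_eq`** — `(∏ᶠ_v ω_v(x_v))·(∏ᶠ_v Q_v(x_v)^{−z}) = ∏ᶠ_v ω_v(x_v)·Q_v(x_v)^{−z}` on `(𝔸_{L⁺,f})³`.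
* §2 HEAD **`exists_pos_integral_prod_chiWeight_mul_heightFactor_cpow_eq`** — ONE constant `C' > 0` with, for every `X_∞`, `S₀` (`hgood` = ★ (a-1) HEAD's bytes), unitary `φ` restricting to `ψ`
  (`hres`), `η := ψ·ω_{L∕L⁺}` unitary, `2 < Re z`, weight family `ω` (`hωc hω1`), global finite weight `Ω` (`hΩ`), joint integrability `hfin`, tokens `hin hsp` (★ (a-1)'s bytes; payable by ★
  `K2E1ChiLocalMeansOfShellU3Letters` from torus-entry witnesses):
  `∫ Ω X b · h_f((X_∞,X),b)^{−z} d(μ_{L,f}⊗μ_{L⁺,f}) = C'·μ³(𝒪̂³)·((∏_{v∈S₀} m_v(z))·[P_L^S(z−1;φ)P_{L⁺}^{S₀}(2z−2;η)]∕[P_L^S(z;φ)P_{L⁺}^{S₀}(2z−1;η)])`, ★ (a-1)'s right side VERBATIM.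
HONEST SCOPE.  NOT here: the global unfolding `(ν𝓕)⁻¹ • ∫_{N(𝔸)} f_z^χ(ι(w₀)n) dν` (★ (ν-1) as in ★ 3-iv-c), the section-factorisation letter producing `Ω` and `hΩ`, the archimedean factor,
and the `hA`∕`A(3∕2) ≠ 0` letters of ★ F5 — file (a-2b) `K2E1ChiIntertwiningScalarEulerProductU3` and its named suppliers.
HONEST LABEL: HC_CM is proved only modulo the 7 printed citations (2 remaining named inputs: hLiu418 = `stmt-HodgeConjecture-24832`, h413 = `stmt-HodgeConjecture-24833`) until rung 0
closes; REL ≠ ★ ≠ BUILT; this file asserts no named fact and closes no socket; count-neutral; §2 is conditional only on its displayed letters.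

## References
* [TateThesis1967] J. Tate, *Fourier analysis in number fields and Hecke's zeta-functions* (1967): §3.3, Thm 3.3.1.
* [Langlands1971] R. P. Langlands, *Euler Products* (1971): §3.
* [Rogawski1990] J. D. Rogawski, *Automorphic Representations of Unitary Groups in Three Variables*, Ann. of Math. Stud. 123 (1990): §4.5, §13.9 p. 229.
* [WeilBNT1967] A. Weil, *Basic Number Theory* (1967): Ch. IV §1.
* [MoeglinWaldspurger1995] C. Mœglin, J.-L. Waldspurger, *Spectral Decomposition and Eisenstein Series* (1995): II.1.7, IV.1.11.
-/

set_option autoImplicit false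
set_option linter.dupNamespace false -- the mandated namespace repeats `HodgeConjecture.HodgeConjecture`

noncomputable section

open MeasureTheory MeasureTheory.Measure NumberField IsDedekindDomain Filter
open scoped NNReal ENNReal
open Literature.NumberTheory.Automorphic Literature.NumberTheory.Automorphic.UnitaryGroup Literature.NumberTheory.GaloisRepresentations
open Literature.NumberTheory.GaloisRepresentations.IsNonarchimedeanLocalField Literature.NumberTheory.LFunctions
open Summit.HodgeConjecture.HodgeConjecture.Cruxes.H413
open Summit.HodgeConjecture.HodgeConjecture.Cruxes.H413.AdelicProductIntegral (exists_finset_mem_offBox offBox_mono finprod_localFactor_eq_prod_of_mem_offBox)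
open Summit.HodgeConjecture.HodgeConjecture.Cruxes.H413.K2E1IntertwiningLocalMeanCMU3 (localHeight_eq_one_of_mem_integralBox)
open Summit.HodgeConjecture.HodgeConjecture.Cruxes.H413.K2E1IntertwiningFiniteTransportU3 (exists_pos_integral_pi_three_eq_smul_integral_prod)
open Summit.HodgeConjecture.HodgeConjecture.Cruxes.H413.K2E1WhittakerFinitePartTransportU3 (ofReal_coe_finprod_heightFactor_cpow_neg_eq)
open Summit.HodgeConjecture.HodgeConjecture.Cruxes.H413.K2E1ChiIntertwiningScalarEulerProductU3Finite (inv_measure_smul_integral_finprod_chi_eq_prod_mul_chiScalar_three)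

namespace Summit.HodgeConjecture.HodgeConjecture.Cruxes.H413.K2E1ChiIntertwiningFiniteTransportU3

variable (L : Type) [Field L] [NumberField L] [IsCMField L] {δ : L} (hcδ : IsCMField.complexConj L δ = -δ) (hδ : δ ≠ 0)
  {d : ↥(maximalRealSubfield L)} (hd : δ * δ = algebraMap ↥(maximalRealSubfield L) L d)
  (S₀ : Finset (HeightOneSpectrum (𝓞 ↥(maximalRealSubfield L))))
  (ω : ∀ v : HeightOneSpectrum (𝓞 ↥(maximalRealSubfield L)), (Fin 3 → v.adicCompletion ↥(maximalRealSubfield L)) → ℂ) (z : ℂ)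

/-! ## §1 Pointwise merge of the two finitely supported Euler products on `(𝔸_{L⁺,f})³` -/

include hd in
/-- **`(∏ᶠ_v ω_v(x_v)) · (∏ᶠ_v Q_v(x_v)^{−z}) = ∏ᶠ_v ω_v(x_v)·Q_v(x_v)^{−z}`** for every `x ∈ (𝔸_{L⁺,f})³`: all three Euler products are finite products over one finset `T ⊇ S₀` with
`x ∈ offBox T` (★ `exists_finset_mem_offBox`, ★ `finprod_localFactor_eq_prod_of_mem_offBox`), because off `S₀` the weight is `1` on `𝒪_v³` (letter `hω1`, ★ (a-1)'s bytes) and so is the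
local height (★ `localHeight_eq_one_of_mem_integralBox`, `hgood`); then `Finset.prod_mul_distrib`. [cite: TateThesis1967, §3.3] [cite: Langlands1971, §3] -/
theorem finprod_chiWeight_mul_finprod_localHeight_cpow_eq
    (hgood : ∀ v ∉ S₀, Algebra.IsUnramifiedIn (𝓞 L) v.asIdeal ∧ Valued.v (2 : v.adicCompletion ↥(maximalRealSubfield L)) = 1 ∧
      ∀ w : PlacesOver L v, Valued.v (algebraMap L (LocalRing L v) δ w) = 1)
    (hω1 : ∀ v ∉ S₀, ∀ p ∈ integralBox ↥(maximalRealSubfield L) (Fin 3) v, ω v p = 1)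
    (x : Fin 3 → FiniteAdeleRing (𝓞 ↥(maximalRealSubfield L)) ↥(maximalRealSubfield L)) :
    (∏ᶠ v : HeightOneSpectrum (𝓞 ↥(maximalRealSubfield L)), ω v (fun i => x i v)) *
        (∏ᶠ v : HeightOneSpectrum (𝓞 ↥(maximalRealSubfield L)), (((∏ w' : PlacesOver L v, max 1 (max ((normAbs (w'.1.adicCompletion L) (quadraticLocalEquiv L v (IsCMField.complexConj L) hcδ hδ (x 0 v, x 1 v) w') : ℝ≥0) : ℝ)
              ((normAbs (w'.1.adicCompletion L) ((toLocalRing L v (x 2 v) * algebraMap L (LocalRing L v) δ -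
                toLocalRing L v 2⁻¹ * (quadraticLocalEquiv L v (IsCMField.complexConj L) hcδ hδ (x 0 v, x 1 v) *
                  conjLocal L (IsCMField.complexConj L) v (quadraticLocalEquiv L v (IsCMField.complexConj L) hcδ hδ (x 0 v, x 1 v)))) w') : ℝ≥0) : ℝ))) : ℝ) : ℂ) ^ (-z)) =
      ∏ᶠ v : HeightOneSpectrum (𝓞 ↥(maximalRealSubfield L)),
        ω v (fun i => x i v) * (((∏ w' : PlacesOver L v, max 1 (max ((normAbs (w'.1.adicCompletion L) (quadraticLocalEquiv L v (IsCMField.complexConj L) hcδ hδ (x 0 v, x 1 v) w') : ℝ≥0) : ℝ)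
              ((normAbs (w'.1.adicCompletion L) ((toLocalRing L v (x 2 v) * algebraMap L (LocalRing L v) δ -
                toLocalRing L v 2⁻¹ * (quadraticLocalEquiv L v (IsCMField.complexConj L) hcδ hδ (x 0 v, x 1 v) *
                  conjLocal L (IsCMField.complexConj L) v (quadraticLocalEquiv L v (IsCMField.complexConj L) hcδ hδ (x 0 v, x 1 v)))) w') : ℝ≥0) : ℝ))) : ℝ) : ℂ) ^ (-z) := by
  classical
  obtain ⟨T₀, hT₀⟩ := exists_finset_mem_offBox x
  have hx : x ∈ offBox (K := ↥(maximalRealSubfield L)) (ι := Fin 3) (S₀ ∪ T₀) := offBox_mono Finset.subset_union_right hT₀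
  have hS : S₀ ⊆ S₀ ∪ T₀ := Finset.subset_union_left
  have hQ1 : ∀ v ∉ S₀, ∀ p ∈ integralBox ↥(maximalRealSubfield L) (Fin 3) v,
      (((∏ w' : PlacesOver L v, max 1 (max ((normAbs (w'.1.adicCompletion L) (quadraticLocalEquiv L v (IsCMField.complexConj L) hcδ hδ (p 0, p 1) w') : ℝ≥0) : ℝ)
              ((normAbs (w'.1.adicCompletion L) ((toLocalRing L v (p 2) * algebraMap L (LocalRing L v) δ -
                toLocalRing L v 2⁻¹ * (quadraticLocalEquiv L v (IsCMField.complexConj L) hcδ hδ (p 0, p 1) *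
                  conjLocal L (IsCMField.complexConj L) v (quadraticLocalEquiv L v (IsCMField.complexConj L) hcδ hδ (p 0, p 1)))) w') : ℝ≥0) : ℝ))) : ℝ) : ℂ) ^ (-z) = 1 := fun v hv p hp => by
    rw [localHeight_eq_one_of_mem_integralBox L hcδ hδ hd v (hgood v hv).1 (hgood v hv).2.1 (hgood v hv).2.2 hp, Complex.ofReal_one, Complex.one_cpow]
  have h1 : (∏ᶠ v : HeightOneSpectrum (𝓞 ↥(maximalRealSubfield L)), ω v (fun i => x i v)) = ∏ v ∈ S₀ ∪ T₀, ω v (fun i => x i v) :=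
    finprod_localFactor_eq_prod_of_mem_offBox ω S₀ hω1 hS hx
  have h2 : (∏ᶠ v : HeightOneSpectrum (𝓞 ↥(maximalRealSubfield L)), (((∏ w' : PlacesOver L v, max 1 (max ((normAbs (w'.1.adicCompletion L) (quadraticLocalEquiv L v (IsCMField.complexConj L) hcδ hδ (x 0 v, x 1 v) w') : ℝ≥0) : ℝ)
              ((normAbs (w'.1.adicCompletion L) ((toLocalRing L v (x 2 v) * algebraMap L (LocalRing L v) δ -
                toLocalRing L v 2⁻¹ * (quadraticLocalEquiv L v (IsCMField.complexConj L) hcδ hδ (x 0 v, x 1 v) *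
                  conjLocal L (IsCMField.complexConj L) v (quadraticLocalEquiv L v (IsCMField.complexConj L) hcδ hδ (x 0 v, x 1 v)))) w') : ℝ≥0) : ℝ))) : ℝ) : ℂ) ^ (-z)) =
      ∏ v ∈ S₀ ∪ T₀, (((∏ w' : PlacesOver L v, max 1 (max ((normAbs (w'.1.adicCompletion L) (quadraticLocalEquiv L v (IsCMField.complexConj L) hcδ hδ (x 0 v, x 1 v) w') : ℝ≥0) : ℝ)
              ((normAbs (w'.1.adicCompletion L) ((toLocalRing L v (x 2 v) * algebraMap L (LocalRing L v) δ -
                toLocalRing L v 2⁻¹ * (quadraticLocalEquiv L v (IsCMField.complexConj L) hcδ hδ (x 0 v, x 1 v) *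
                  conjLocal L (IsCMField.complexConj L) v (quadraticLocalEquiv L v (IsCMField.complexConj L) hcδ hδ (x 0 v, x 1 v)))) w') : ℝ≥0) : ℝ))) : ℝ) : ℂ) ^ (-z) :=
    finprod_localFactor_eq_prod_of_mem_offBox (fun v p => (((∏ w' : PlacesOver L v, max 1 (max ((normAbs (w'.1.adicCompletion L) (quadraticLocalEquiv L v (IsCMField.complexConj L) hcδ hδ (p 0, p 1) w') : ℝ≥0) : ℝ)
              ((normAbs (w'.1.adicCompletion L) ((toLocalRing L v (p 2) * algebraMap L (LocalRing L v) δ -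
                toLocalRing L v 2⁻¹ * (quadraticLocalEquiv L v (IsCMField.complexConj L) hcδ hδ (p 0, p 1) *
                  conjLocal L (IsCMField.complexConj L) v (quadraticLocalEquiv L v (IsCMField.complexConj L) hcδ hδ (p 0, p 1)))) w') : ℝ≥0) : ℝ))) : ℝ) : ℂ) ^ (-z)) S₀ hQ1 hS hx
  have h3 : (∏ᶠ v : HeightOneSpectrum (𝓞 ↥(maximalRealSubfield L)), ω v (fun i => x i v) * (((∏ w' : PlacesOver L v, max 1 (max ((normAbs (w'.1.adicCompletion L) (quadraticLocalEquiv L v (IsCMField.complexConj L) hcδ hδ (x 0 v, x 1 v) w') : ℝ≥0) : ℝ)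
              ((normAbs (w'.1.adicCompletion L) ((toLocalRing L v (x 2 v) * algebraMap L (LocalRing L v) δ -
                toLocalRing L v 2⁻¹ * (quadraticLocalEquiv L v (IsCMField.complexConj L) hcδ hδ (x 0 v, x 1 v) *
                  conjLocal L (IsCMField.complexConj L) v (quadraticLocalEquiv L v (IsCMField.complexConj L) hcδ hδ (x 0 v, x 1 v)))) w') : ℝ≥0) : ℝ))) : ℝ) : ℂ) ^ (-z)) =
      ∏ v ∈ S₀ ∪ T₀, ω v (fun i => x i v) * (((∏ w' : PlacesOver L v, max 1 (max ((normAbs (w'.1.adicCompletion L) (quadraticLocalEquiv L v (IsCMField.complexConj L) hcδ hδ (x 0 v, x 1 v) w') : ℝ≥0) : ℝ)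
              ((normAbs (w'.1.adicCompletion L) ((toLocalRing L v (x 2 v) * algebraMap L (LocalRing L v) δ -
                toLocalRing L v 2⁻¹ * (quadraticLocalEquiv L v (IsCMField.complexConj L) hcδ hδ (x 0 v, x 1 v) *
                  conjLocal L (IsCMField.complexConj L) v (quadraticLocalEquiv L v (IsCMField.complexConj L) hcδ hδ (x 0 v, x 1 v)))) w') : ℝ≥0) : ℝ))) : ℝ) : ℂ) ^ (-z) :=
    finprod_localFactor_eq_prod_of_mem_offBox (fun v p => ω v p * (((∏ w' : PlacesOver L v, max 1 (max ((normAbs (w'.1.adicCompletion L) (quadraticLocalEquiv L v (IsCMField.complexConj L) hcδ hδ (p 0, p 1) w') : ℝ≥0) : ℝ)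
              ((normAbs (w'.1.adicCompletion L) ((toLocalRing L v (p 2) * algebraMap L (LocalRing L v) δ -
                toLocalRing L v 2⁻¹ * (quadraticLocalEquiv L v (IsCMField.complexConj L) hcδ hδ (p 0, p 1) *
                  conjLocal L (IsCMField.complexConj L) v (quadraticLocalEquiv L v (IsCMField.complexConj L) hcδ hδ (p 0, p 1)))) w') : ℝ≥0) : ℝ))) : ℝ) : ℂ) ^ (-z)) S₀
      (fun v hv p hp => by rw [hω1 v hv p hp, hQ1 v hv p hp, one_mul]) hS hx
  rw [h1, h2, h3, ← Finset.prod_mul_distrib]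

/-! ## §2 HEAD: the χ-weighted finite double integral is `C'·μ³(𝒪̂³)·(∏_{v∈S₀} m_v(z))·c_χ^S(z)` -/

variable [MeasurableSpace (FiniteAdeleRing (𝓞 ↥(maximalRealSubfield L)) ↥(maximalRealSubfield L))] [BorelSpace (FiniteAdeleRing (𝓞 ↥(maximalRealSubfield L)) ↥(maximalRealSubfield L))]
  [MeasurableSpace (FiniteAdeleRing (𝓞 L) L)] [BorelSpace (FiniteAdeleRing (𝓞 L) L)]
  (μFf : Measure (FiniteAdeleRing (𝓞 ↥(maximalRealSubfield L)) ↥(maximalRealSubfield L))) [μFf.IsAddHaarMeasure]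
  (μEf : Measure (FiniteAdeleRing (𝓞 L) L)) [μEf.IsAddHaarMeasure]
  [∀ v : HeightOneSpectrum (𝓞 ↥(maximalRealSubfield L)), MeasurableSpace (v.adicCompletion ↥(maximalRealSubfield L))] [∀ v : HeightOneSpectrum (𝓞 ↥(maximalRealSubfield L)), BorelSpace (v.adicCompletion ↥(maximalRealSubfield L))]
  (νv : ∀ v : HeightOneSpectrum (𝓞 ↥(maximalRealSubfield L)), Measure (v.adicCompletion ↥(maximalRealSubfield L))) [∀ v, (νv v).IsAddHaarMeasure]

include hd in
/-- **THE FINITE PART OF THE χ-WEIGHTED INTERTWINING INTEGRAL OF `U(2,1)_{L∕L⁺}`, TRANSPORTED AND EVALUATED** (`2 < Re z`): there is ONE constant `C' > 0` (★ (3-iv-b) §1's CM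
transport constant, inverted) such that for every archimedean parameter `X_∞`, every bad finset `S₀` with ★ (a-1)'s good-place package `hgood`, every unitary Hecke character `φ` of `L`
restricting to `ψ` on `𝕀_{L⁺}` (`hres`) with `ψ·ω_{L∕L⁺}` unitary, every `z` with `2 < Re z`, every local weight family `ω` with ★ (a-1)'s letters `hωc hω1`, every GLOBAL finite weight
`Ω : 𝔸_{L,f} → 𝔸_{L⁺,f} → ℂ` with the PURE-TENSOR letter `hΩ`, the joint integrability `hfin`, and ★ (a-1)'s token letters `hin hsp`:
`∫ Ω X b · (h_f((X_∞,X),b) : ℂ)^{−z} d(μ_{L,f}⊗μ_{L⁺,f})(X,b) = C'·μ³(𝒪̂³)·((∏_{v∈S₀} ν_v(𝒪_v³)⁻¹ • ∫ ω_v Q_v^{−z}) · [P_L^S(z−1;φ)·P_{L⁺}^{S₀}(2z−2;η)] ∕ [P_L^S(z;φ)·P_{L⁺}^{S₀}(2z−1;η)])`,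
`η := ψ·ω_{L∕L⁺}`, `S := {w ∣ w ∩ 𝓞L⁺ ∈ S₀}` (★ (3-iv-b) §1 ∘ ★ cpow dictionary ∘ §1 ∘ ★ (a-1) HEAD with `hint := ` the transported `hfin`).
[cite: TateThesis1967, Thm 3.3.1] [cite: Langlands1971, §3] [cite: Rogawski1990, §13.9 p. 229] [cite: WeilBNT1967, Ch. IV §1] -/
theorem exists_pos_integral_prod_chiWeight_mul_heightFactor_cpow_eq {φ : HeckeCharacter L} {ψ : HeckeCharacter ↥(maximalRealSubfield L)} (hφ : φ.IsUnitary)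
    (hψ : (ψ * quadraticHeckeCharCM L).IsUnitary) (hres : ∀ x, φ (AdeleRing.ideleBaseChange ↥(maximalRealSubfield L) L x) = ψ x) :
    ∃ C' : ℝ≥0, 0 < C' ∧ ∀ (Xinf : InfiniteAdeleRing L) (S₀ : Finset (HeightOneSpectrum (𝓞 ↥(maximalRealSubfield L))))
      (hgood : ∀ v ∉ S₀, (Algebra.IsUnramifiedIn (𝓞 L) v.asIdeal ∧ Valued.v (2 : v.adicCompletion ↥(maximalRealSubfield L)) = 1 ∧
        ∀ w : PlacesOver L v, Valued.v (algebraMap L (LocalRing L v) δ w) = 1) ∧ ∀ w : PlacesOver L v, φ.IsUnramifiedAt w.1)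
      {z : ℂ} (hz : 2 < z.re)
      (ω : ∀ v : HeightOneSpectrum (𝓞 ↥(maximalRealSubfield L)), (Fin 3 → v.adicCompletion ↥(maximalRealSubfield L)) → ℂ)
      (hωc : ∀ v, Continuous fun p : Fin 3 → v.adicCompletion ↥(maximalRealSubfield L) =>
        ω v p * (((∏ w' : PlacesOver L v, max 1 (max ((normAbs (w'.1.adicCompletion L) (quadraticLocalEquiv L v (IsCMField.complexConj L) hcδ hδ (p 0, p 1) w') : ℝ≥0) : ℝ)
            ((normAbs (w'.1.adicCompletion L) ((toLocalRing L v (p 2) * algebraMap L (LocalRing L v) δ -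
              toLocalRing L v 2⁻¹ * (quadraticLocalEquiv L v (IsCMField.complexConj L) hcδ hδ (p 0, p 1) *
                conjLocal L (IsCMField.complexConj L) v (quadraticLocalEquiv L v (IsCMField.complexConj L) hcδ hδ (p 0, p 1)))) w') : ℝ≥0) : ℝ))) : ℝ) : ℂ) ^ (-z))
      (hω1 : ∀ v ∉ S₀, ∀ p ∈ integralBox ↥(maximalRealSubfield L) (Fin 3) v, ω v p = 1)
      (Ω : FiniteAdeleRing (𝓞 L) L → FiniteAdeleRing (𝓞 ↥(maximalRealSubfield L)) ↥(maximalRealSubfield L) → ℂ)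
      (hΩ : ∀ x : Fin 3 → FiniteAdeleRing (𝓞 ↥(maximalRealSubfield L)) ↥(maximalRealSubfield L),
        Ω (quadraticFiniteAdeleMap ↥(maximalRealSubfield L) L δ (x 0, x 1)) (x 2) = ∏ᶠ v : HeightOneSpectrum (𝓞 ↥(maximalRealSubfield L)), ω v (fun i => x i v))
      (hfin : Integrable (fun q : FiniteAdeleRing (𝓞 L) L × FiniteAdeleRing (𝓞 ↥(maximalRealSubfield L)) ↥(maximalRealSubfield L) =>
        Ω q.1 q.2 * ((((∏ᶠ w : HeightOneSpectrum (𝓞 L), max 1 (max ‖((Xinf, q.1) : AdeleRing (𝓞 L) L).2 w‖₊ ‖(heisZ (c := IsCMField.complexConj L) ((Xinf, q.1) : AdeleRing (𝓞 L) L) ((traceZeroLine ↥(maximalRealSubfield L) L (IsCMField.complexConj L) hcδ hδ ((0, q.2) : AdeleRing (𝓞 ↥(maximalRealSubfield L)) ↥(maximalRealSubfield L)) : traceZeroAdele ↥(maximalRealSubfield L) L (IsCMField.complexConj L)) : AdeleRing (𝓞 L) L)).2 w‖₊) : ℝ≥0) : ℝ) : ℂ) ^ (-z))) (μEf.prod 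μFf))
      (hin : ∀ v ∉ S₀, ∀ w : PlacesOver L v, IsCMField.complexConj L • w.1 = w.1 →
        ((Measure.pi fun _ : Fin 3 => νv v) (integralBox ↥(maximalRealSubfield L) (Fin 3) v)).toReal⁻¹ •
            ∫ p : Fin 3 → v.adicCompletion ↥(maximalRealSubfield L),
              ω v p * (((∏ w' : PlacesOver L v, max 1 (max ((normAbs (w'.1.adicCompletion L) (quadraticLocalEquiv L v (IsCMField.complexConj L) hcδ hδ (p 0, p 1) w') : ℝ≥0) : ℝ)
                ((normAbs (w'.1.adicCompletion L) ((toLocalRing L v (p 2) * algebraMap L (LocalRing L v) δ -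
                  toLocalRing L v 2⁻¹ * (quadraticLocalEquiv L v (IsCMField.complexConj L) hcδ hδ (p 0, p 1) *
                    conjLocal L (IsCMField.complexConj L) v (quadraticLocalEquiv L v (IsCMField.complexConj L) hcδ hδ (p 0, p 1)))) w') : ℝ≥0) : ℝ))) : ℝ) : ℂ) ^ (-z)
              ∂(Measure.pi fun _ : Fin 3 => νv v) =
          (1 - φ.valueAtUniformizer w.1 * (v.residueCard : ℂ) ^ (-(2 * z))) * (1 + φ.valueAtUniformizer w.1 * (v.residueCard : ℂ) ^ (-(2 * z - 1))) /
            ((1 - φ.valueAtUniformizer w.1 * (v.residueCard : ℂ) ^ (-(2 * z - 2))) * (1 + φ.valueAtUniformizer w.1 * (v.residueCard : ℂ) ^ (-(2 * z - 2)))))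
      (hsp : ∀ v ∉ S₀, ∀ w : PlacesOver L v, IsCMField.complexConj L • w.1 ≠ w.1 →
        ((Measure.pi fun _ : Fin 3 => νv v) (integralBox ↥(maximalRealSubfield L) (Fin 3) v)).toReal⁻¹ •
            ∫ p : Fin 3 → v.adicCompletion ↥(maximalRealSubfield L),
              ω v p * (((∏ w' : PlacesOver L v, max 1 (max ((normAbs (w'.1.adicCompletion L) (quadraticLocalEquiv L v (IsCMField.complexConj L) hcδ hδ (p 0, p 1) w') : ℝ≥0) : ℝ)
                ((normAbs (w'.1.adicCompletion L) ((toLocalRing L v (p 2) * algebraMap L (LocalRing L v) δ -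
                  toLocalRing L v 2⁻¹ * (quadraticLocalEquiv L v (IsCMField.complexConj L) hcδ hδ (p 0, p 1) *
                    conjLocal L (IsCMField.complexConj L) v (quadraticLocalEquiv L v (IsCMField.complexConj L) hcδ hδ (p 0, p 1)))) w') : ℝ≥0) : ℝ))) : ℝ) : ℂ) ^ (-z)
              ∂(Measure.pi fun _ : Fin 3 => νv v) =
          (1 - φ.valueAtUniformizer w.1 * (v.residueCard : ℂ) ^ (-z)) * (1 - φ.valueAtUniformizer (PlacesOver.galInv (IsCMField.complexConj L) w).1 * (v.residueCard : ℂ) ^ (-z)) *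
              (1 - φ.valueAtUniformizer w.1 * φ.valueAtUniformizer (PlacesOver.galInv (IsCMField.complexConj L) w).1 * (v.residueCard : ℂ) ^ (-(2 * z - 1))) /
            ((1 - φ.valueAtUniformizer w.1 * (v.residueCard : ℂ) ^ (-(z - 1))) * (1 - φ.valueAtUniformizer (PlacesOver.galInv (IsCMField.complexConj L) w).1 * (v.residueCard : ℂ) ^ (-(z - 1))) *
              (1 - φ.valueAtUniformizer w.1 * φ.valueAtUniformizer (PlacesOver.galInv (IsCMField.complexConj L) w).1 * (v.residueCard : ℂ) ^ (-(2 * z - 2))))),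
      ∫ q : FiniteAdeleRing (𝓞 L) L × FiniteAdeleRing (𝓞 ↥(maximalRealSubfield L)) ↥(maximalRealSubfield L),
          Ω q.1 q.2 * ((((∏ᶠ w : HeightOneSpectrum (𝓞 L), max 1 (max ‖((Xinf, q.1) : AdeleRing (𝓞 L) L).2 w‖₊ ‖(heisZ (c := IsCMField.complexConj L) ((Xinf, q.1) : AdeleRing (𝓞 L) L) ((traceZeroLine ↥(maximalRealSubfield L) L (IsCMField.complexConj L) hcδ hδ ((0, q.2) : AdeleRing (𝓞 ↥(maximalRealSubfield L)) ↥(maximalRealSubfield L)) : traceZeroAdele ↥(maximalRealSubfield L) L (IsCMField.complexConj L)) : AdeleRing (𝓞 L) L)).2 w‖₊) : ℝ≥0) : ℝ) : ℂ) ^ (-z)) ∂(μEf.prod μFf) =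
        (C' : ℂ) * ((((Measure.pi fun _ : Fin 3 => μFf) (offBox (K := ↥(maximalRealSubfield L)) (ι := Fin 3) ∅)).toReal : ℂ) *
          (∏ v ∈ S₀, ((Measure.pi fun _ : Fin 3 => νv v) (integralBox ↥(maximalRealSubfield L) (Fin 3) v)).toReal⁻¹ •
              ∫ p : Fin 3 → v.adicCompletion ↥(maximalRealSubfield L),
                ω v p * (((∏ w' : PlacesOver L v, max 1 (max ((normAbs (w'.1.adicCompletion L) (quadraticLocalEquiv L v (IsCMField.complexConj L) hcδ hδ (p 0, p 1) w') : ℝ≥0) : ℝ)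
                  ((normAbs (w'.1.adicCompletion L) ((toLocalRing L v (p 2) * algebraMap L (LocalRing L v) δ -
                    toLocalRing L v 2⁻¹ * (quadraticLocalEquiv L v (IsCMField.complexConj L) hcδ hδ (p 0, p 1) *
                      conjLocal L (IsCMField.complexConj L) v (quadraticLocalEquiv L v (IsCMField.complexConj L) hcδ hδ (p 0, p 1)))) w') : ℝ≥0) : ℝ))) : ℝ) : ℂ) ^ (-z)
                ∂(Measure.pi fun _ : Fin 3 => νv v)) *
            ((partialStandardL {w : HeightOneSpectrum (𝓞 L) | w.under (𝓞 ↥(maximalRealSubfield L)) ∈ (↑S₀ : Set (HeightOneSpectrum (𝓞 ↥(maximalRealSubfield L))))} (fun w => {φ.valueAtUniformizer w}) (z - 1) *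
                partialStandardL (↑S₀ : Set (HeightOneSpectrum (𝓞 ↥(maximalRealSubfield L)))) (fun v => {(ψ * quadraticHeckeCharCM L).valueAtUniformizer v}) (2 * z - 2)) /
              (partialStandardL {w : HeightOneSpectrum (𝓞 L) | w.under (𝓞 ↥(maximalRealSubfield L)) ∈ (↑S₀ : Set (HeightOneSpectrum (𝓞 ↥(maximalRealSubfield L))))} (fun w => {φ.valueAtUniformizer w}) z *
                partialStandardL (↑S₀ : Set (HeightOneSpectrum (𝓞 ↥(maximalRealSubfield L)))) (fun v => {(ψ * quadraticHeckeCharCM L).valueAtUniformizer v}) (2 * z - 1)))) := by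
  haveI : SecondCountableTopology (FiniteAdeleRing (𝓞 ↥(maximalRealSubfield L)) ↥(maximalRealSubfield L)) := secondCountableTopology_finiteAdeleRing _
  haveI : LocallyCompactSpace (FiniteAdeleRing (𝓞 ↥(maximalRealSubfield L)) ↥(maximalRealSubfield L)) := locallyCompactSpace_finiteAdeleRing' _
  obtain ⟨C, hC, hall⟩ := exists_pos_integral_pi_three_eq_smul_integral_prod L μFf μEf hcδ hδ
  refine ⟨C⁻¹, inv_pos.2 hC, fun Xinf S₀ hgood z hz ω hωc hω1 Ω hΩ hfin hin hsp => ?_⟩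
  -- the transport (★ (3-iv-b) §1) of the weighted integrand
  obtain ⟨hval, hiff⟩ := hall fun X b => Ω X b * ((((∏ᶠ w : HeightOneSpectrum (𝓞 L), max 1 (max ‖((Xinf, X) : AdeleRing (𝓞 L) L).2 w‖₊ ‖(heisZ (c := IsCMField.complexConj L) ((Xinf, X) : AdeleRing (𝓞 L) L) ((traceZeroLine ↥(maximalRealSubfield L) L (IsCMField.complexConj L) hcδ hδ ((0, b) : AdeleRing (𝓞 ↥(maximalRealSubfield L)) ↥(maximalRealSubfield L)) : traceZeroAdele ↥(maximalRealSubfield L) L (IsCMField.complexConj L)) : AdeleRing (𝓞 L) L)).2 w‖₊) : ℝ≥0) : ℝ) : ℂ) ^ (-z))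
  -- pointwise on `(𝔸_{L⁺,f})³`: the pure-tensor letter, ★ the cpow dictionary, §1
  have hpt : (fun x : Fin 3 → FiniteAdeleRing (𝓞 ↥(maximalRealSubfield L)) ↥(maximalRealSubfield L) =>
      Ω (quadraticFiniteAdeleMap ↥(maximalRealSubfield L) L δ (x 0, x 1)) (x 2) * ((((∏ᶠ w : HeightOneSpectrum (𝓞 L), max 1 (max ‖((Xinf, quadraticFiniteAdeleMap ↥(maximalRealSubfield L) L δ (x 0, x 1)) : AdeleRing (𝓞 L) L).2 w‖₊ ‖(heisZ (c := IsCMField.complexConj L) ((Xinf, quadraticFiniteAdeleMap ↥(maximalRealSubfield L) L δ (x 0, x 1)) : AdeleRing (𝓞 L) L) ((traceZeroLine ↥(maximalRealSubfield L) L (IsCMField.complexConj L) hcδ hδ ((0, x 2) : AdeleRing (𝓞 ↥(maximalRealSubfield L)) ↥(maximalRealSubfield L)) : traceZeroAdele ↥(maximalRealSubfield L) L (IsCMField.complexConj L)) : AdeleRing (𝓞 L) L)).2 w‖₊) : ℝ≥0) : ℝ) : ℂ) ^ (-z))) =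
      fun x => ∏ᶠ v : HeightOneSpectrum (𝓞 ↥(maximalRealSubfield L)),
        ω v (fun i => x i v) * (((∏ w' : PlacesOver L v, max 1 (max ((normAbs (w'.1.adicCompletion L) (quadraticLocalEquiv L v (IsCMField.complexConj L) hcδ hδ (x 0 v, x 1 v) w') : ℝ≥0) : ℝ)
              ((normAbs (w'.1.adicCompletion L) ((toLocalRing L v (x 2 v) * algebraMap L (LocalRing L v) δ -
                toLocalRing L v 2⁻¹ * (quadraticLocalEquiv L v (IsCMField.complexConj L) hcδ hδ (x 0 v, x 1 v) *
                  conjLocal L (IsCMField.complexConj L) v (quadraticLocalEquiv L v (IsCMField.complexConj L) hcδ hδ (x 0 v, x 1 v)))) w') : ℝ≥0) : ℝ))) : ℝ) : ℂ) ^ (-z) :=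
    funext fun x => by
      rw [hΩ x, ofReal_coe_finprod_heightFactor_cpow_neg_eq L hcδ hδ Xinf (x 0) (x 1) (x 2) z,
        finprod_chiWeight_mul_finprod_localHeight_cpow_eq L hcδ hδ hd S₀ ω z (fun v hv => (hgood v hv).1) hω1 x]
  rw [hpt] at hval hiff
  -- ★ (a-1): Tate 3.3.1 with the good-place tokens, `hint` = the transported `hfin`
  have hP := inv_measure_smul_integral_finprod_chi_eq_prod_mul_chiScalar_three L hcδ hδ hd (Measure.pi fun _ : Fin 3 => μFf) νv S₀ ω z hφ hψ hres hz hgood hωc hω1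
    (hiff.2 hfin) hin hsp
  -- `μ³(𝒪̂³)⁻¹ • ∫ = P` ⟹ `∫ = μ³(𝒪̂³) · P`; then `C • I = ∫` ⟹ `I = C⁻¹ · ∫`
  have hc0 : ((Measure.pi fun _ : Fin 3 => μFf) (offBox (K := ↥(maximalRealSubfield L)) (ι := Fin 3) ∅)).toReal ≠ 0 :=
    ENNReal.toReal_ne_zero.mpr ⟨(measure_offBox_empty_pos ↥(maximalRealSubfield L) (Fin 3) _).ne', (measure_offBox_empty_lt_top ↥(maximalRealSubfield L) (Fin 3) _).ne⟩
  rw [Complex.real_smul, Complex.ofReal_inv, inv_mul_eq_iff_eq_mul₀ (by exact_mod_cast hc0)] at hP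
  rw [hP, Complex.real_smul] at hval
  have hC0 : (C : ℂ) ≠ 0 := by exact_mod_cast hC.ne'
  rw [← inv_mul_eq_iff_eq_mul₀ hC0] at hval
  rw [← hval, NNReal.coe_inv, Complex.ofReal_inv, mul_assoc]

end Summit.HodgeConjecture.HodgeConjecture.Cruxes.H413.K2E1ChiIntertwiningFiniteTransportU3

end
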